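import Literature.NumberTheory.Automorphic.UnitaryGroupBorelInduction   -- ★ `UnitaryGroup.torusU`, `mem_torusU_iff`, `borelTriple_M`, `StdForm.antidiagonal`
import Literature.NumberTheory.Rogawski1990.LocalTransfer                -- ★ `IsRegularElt` (:228), `isRegularElt_conj_iff`
import HarnessLib

/-!
# F0 · P3c · line LH6 «StCharTS» — «WEYL-HYP★» STAGE (A): REGULAR-FIBRE STRUCTURE OF THE SPLIT TORUS `M = T` IN `U(σ, J)(R)`
# (centraliser of a regular diagonal element, normaliser `N(M) = M ⊔ w·M`, fibres of `(gM, m) ↦ g m g⁻¹`) [Rogawski1990 §12.5 p. 182; vanDijk1972 §2]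

Cell `pub/hodgecm-mathlib`, crux H413 = `stmt-HodgeConjecture-24833` (`--supports` lane, helper), route HCCMUnconditional; seat LH2-p01 (g3), deal «WEYL-HYP★ — stage (A)»
of F0P3b-plan (g23) 2026-09-02T05:26:46Z (desk heir F0P3-plan (g14) 05:26:18Z routing).  THEOREMS ONLY, sorry-free, no definition ∕ instance ∕ notation ∕ named fact.
PURPOSE.  Every in-house discharge of the split-torus inputs (WM)∕(HM)∕(PSM) of the LH6 leaf («`tr σ(φ) = ∫_M F_φ Θ_σ` for `φ` supported in the hyperbolic set `Ω`») runs
through the WEYL INTEGRATION FORMULA ON THE HYPERBOLIC SET of `G = U(Φ₃)(L⁺_v)` w.r.t. the split torus `M = (cmBorelTriple L 3 v).M = torusU σ J` (★ `borelTriple_M`,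
`rfl`).  Stage (A) is its group theory; stage (B) (the measure identity `∫_Ω φ = ½ ∫_{M^{reg}} |D(m)| ∫_{G∕M} φ(g m g⁻¹)`) is a later brick.

THE CARRIER is kept GENERIC: `U := ↥(unitaryGroupOfForm σ J)` over ANY commutative ring `R` with ANY endomorphism `σ` and form `J` (so the CM local carrier
`(cmDatum L N Φ_N).Local v = ↥(unitaryGroupOfForm (conjLocal L c v) (cmLocalForm L N v))`, ★ `cmDatum_Local_eq`, is an instance ON THE NOSE), `T := torusU σ J` the diagonal
torus (★ `UnitaryGroupBorelInduction` :115).  REGULARITY of a diagonal `m = diag(d)` is used in the convenient form «UNIT DIFFERENCES» `∀ i ≠ j, IsUnit (dᵢ − dⱼ)`; the link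
from the tree's `IsRegularElt` (separable characteristic polynomial, ★ `LocalTransfer` :228) is `isUnit_sub_of_isRegularElt_glDiagonal`.

* §1 (A0) `mem_torusU_iff_forall_apply_eq_zero` — `g ∈ T ↔` the matrix of `g` is diagonal (an invertible diagonal matrix has unit diagonal).
* §1 (A0′) `isUnit_sub_of_separable_prod_X_sub_C`, `isUnit_sub_of_isRegularElt_glDiagonal` — separable `∏ (X − dᵢ)` ⇒ unit differences.
* §2 (A1) **`centralizer_eq_torusU_of_glDiagonal_eq`** — for `m = diag(d) ∈ T` with unit differences, `Z_U(m) = Subgroup.centralizer {m} = T` (any `R`, `σ`, `J`, `N`);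
  `centralizer_eq_torusU_of_isRegularElt` — the same from `IsRegularElt`.
* §3 (A3) **`exists_mem_normalizer_of_conj_eq_conj`** — PURE GROUP THEORY: if `Z(m) = M = Z(m′)` and `g m g⁻¹ = g′ m′ g′⁻¹` then `g′ = g n` with `n ∈ N(M)` and
  `m = n m′ n⁻¹` (the fibres of `q : G∕M × M^{reg} → G` are `N(M)∕M`-torsors); `exists_mem_normalizer_torusU_of_conj_eq_conj` — its reading on `T` through (A1).
* (A2) «`N(T) = T ⊔ w·T`» (the normaliser at `N = 3`, `J = Φ₃`, field-like `R`) is the SIBLING file `F0P3cStCharTSWeylHypNormaliser` (400-line rule).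
NOT HERE (honest census): (A4) «`Ω = ⋃_g g T^{reg} g⁻¹` is OPEN» needs a `p`-adic submersion ∕ inverse-function input the tree does not hold — it is stage (B)'s first
hypothesis; nothing in this file is measure-theoretic.
HONEST LABEL: HC_CM is proved only modulo the 7 printed citations (2 remaining: hLiu418 = `stmt-HodgeConjecture-24832`, h413 = `stmt-HodgeConjecture-24833`) until rung 0
closes; this file is count-neutral group theory for the (WM)∕(HM) road and closes no organ.

## References
* [Rogawski1990] J. D. Rogawski, *Automorphic Representations of Unitary Groups in Three Variables*, Ann. of Math. Stud. 123 (1990), §12.5 p. 182 (Weyl integration on the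
  split torus), §1.10 p. 9 (`B = MN`, `M` the diagonal subgroup), §3.1 p. 19 (regular elements).
* [vanDijk1972] G. van Dijk, *Computation of certain induced characters of `p`-adic groups*, Math. Ann. 199 (1972), §2 (Weyl integration formula on `G^{reg}`).
* [SpringerLAG1998] T. A. Springer, *Linear Algebraic Groups*, 2nd ed. (1998), 8.1.12 (3) (centralisers of semisimple elements), 7.1.5 (normaliser of a maximal torus).
-/

set_option autoImplicit false
set_option linter.dupNamespace false

open Matrix Polynomial
open Literature.NumberTheory.Automorphic Literature.NumberTheory.Automorphic.UnitaryGroup Literature.NumberTheory.Rogawski1990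
open scoped MatrixGroups

namespace Summit.HodgeConjecture.HodgeConjecture.Cruxes.H413.F0P3cStCharTSWeylHypFibre

/-! ## §1 (A0) The diagonal torus entrywise; (A0′) regularity as unit differences -/

section Torus

variable {R : Type*} [CommRing R] (σ : R →+* R) {N : ℕ} (J : Matrix (Fin N) (Fin N) R)

/-- **(A0) `g ∈ T ↔ g` is diagonal**: an element of `U(σ, J)(R)` lies in the diagonal torus `torusU σ J` iff all off-diagonal entries of its matrix vanish (the diagonal
entries of an invertible diagonal matrix are units: `g_{ii} · (g⁻¹)_{ii} = 1`). [cite: Rogawski1990, §1.10 p. 9] -/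
theorem mem_torusU_iff_forall_apply_eq_zero (g : ↥(unitaryGroupOfForm σ J)) :
    g ∈ torusU σ J ↔ ∀ i j : Fin N, i ≠ j → ((g : GL (Fin N) R) : Matrix (Fin N) (Fin N) R) i j = 0 := by
  constructor
  · rintro ⟨d, hd⟩ i j hij
    have h := congrArg (fun x : GL (Fin N) R => (x : Matrix (Fin N) (Fin N) R) i j) hd
    simp only [coe_glDiagonal, diagonal_apply_ne _ hij] at h
    exact h.symm
  · intro h
    set G : Matrix (Fin N) (Fin N) R := ((g : GL (Fin N) R) : Matrix (Fin N) (Fin N) R) with hG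
    set G' : Matrix (Fin N) (Fin N) R := (((g : GL (Fin N) R)⁻¹ : GL (Fin N) R) : Matrix (Fin N) (Fin N) R) with hG'
    have hGG' : G * G' = 1 := by rw [hG, hG', ← Units.val_mul, mul_inv_cancel, Units.val_one]
    have hG'G : G' * G = 1 := by rw [hG, hG', ← Units.val_mul, inv_mul_cancel, Units.val_one]
    -- the diagonal entries are units with inverses the diagonal entries of `g⁻¹`
    have h1 : ∀ i, G i i * G' i i = 1 := by
      intro i
      have e := congrFun (congrFun hGG' i) i
      rw [Matrix.mul_apply, Finset.sum_eq_single i (fun k _ hk => by rw [h i k (Ne.symm hk), zero_mul]) (fun hi => absurd (Finset.mem_univ i) hi),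
        Matrix.one_apply_eq] at e
      exact e
    have h2 : ∀ i, G' i i * G i i = 1 := by
      intro i
      have e := congrFun (congrFun hG'G i) i
      rw [Matrix.mul_apply, Finset.sum_eq_single i (fun k _ hk => by rw [h k i hk, mul_zero]) (fun hi => absurd (Finset.mem_univ i) hi),
        Matrix.one_apply_eq] at e
      exact e
    refine ⟨fun i => ⟨G i i, G' i i, h1 i, h2 i⟩, Units.ext ?_⟩
    rw [coe_glDiagonal, Subgroup.coe_subtype]
    ext i j
    by_cases hij : i = j
    · subst hij; rw [diagonal_apply_eq]
    · rw [diagonal_apply_ne _ hij]; exact (h i j hij).symm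

/-- **Separable `∏ (X − dᵢ)` ⇒ unit differences** (any commutative ring): if `∏_{i} (X − C dᵢ)` is separable then `dᵢ − dⱼ` is a unit for `i ≠ j` (the two factors are
coprime; evaluate a Bézout identity at `dᵢ`). [cite: Rogawski1990, §3.1 p. 19] -/
theorem isUnit_sub_of_separable_prod_X_sub_C {ι : Type*} [Fintype ι] [DecidableEq ι] {d : ι → R}
    (h : (∏ i, (X - C (d i))).Separable) {i j : ι} (hij : i ≠ j) : IsUnit (d i - d j) := by
  -- the product of the two factors divides the full product
  have hdvd : (X - C (d i)) * (X - C (d j)) ∣ ∏ k, (X - C (d k)) := by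
    rw [← Finset.mul_prod_erase Finset.univ (fun k => X - C (d k)) (Finset.mem_univ i)]
    exact mul_dvd_mul_left _ (Finset.dvd_prod_of_mem (fun k => X - C (d k)) (Finset.mem_erase.2 ⟨hij.symm, Finset.mem_univ j⟩))
  have hsep := h.of_dvd hdvd
  obtain ⟨u, v, huv⟩ := hsep.isCoprime
  have e := congrArg (Polynomial.eval (d i)) huv
  simp only [eval_add, eval_mul, eval_sub, eval_X, eval_C, sub_self, mul_zero, zero_add, eval_one] at e
  exact IsUnit.of_mul_eq_one _ (by rwa [mul_comm] at e)

/-- **(A0′) `IsRegularElt (diag d)` ⇒ unit differences** (★ `IsRegularElt` = separable characteristic polynomial; `charpoly (diagonal d) = ∏ (X − C dᵢ)`).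
[cite: Rogawski1990, §3.1 p. 19] -/
theorem isUnit_sub_of_isRegularElt_glDiagonal {d : Fin N → Rˣ} (h : IsRegularElt (glDiagonal N R d)) {i j : Fin N} (hij : i ≠ j) :
    IsUnit ((d i : R) - d j) := by
  rw [IsRegularElt, coe_glDiagonal, Matrix.charpoly_diagonal] at h
  exact isUnit_sub_of_separable_prod_X_sub_C h hij

end Torus

/-! ## §2 (A1) The centraliser of a regular diagonal element is the torus -/

section Centraliser

variable {R : Type*} [CommRing R] (σ : R →+* R) {N : ℕ} (J : Matrix (Fin N) (Fin N) R)

/-- **(A1) `Z_U(m) = T` for a regular diagonal `m`** (any commutative ring `R`, any `σ`, `J`, `N`): if `m ∈ U(σ,J)(R)` has matrix `diag(d)` with `dᵢ − dⱼ` units for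
`i ≠ j`, then `Subgroup.centralizer {m} = torusU σ J` — `g m = m g` reads `g_{ij}(d_j − d_i) = 0`, so `g` is diagonal; conversely diagonal matrices commute.
[cite: Rogawski1990, §12.5 p. 182; §1.10 p. 9] [cite: SpringerLAG1998, 8.1.12 (3)] -/
theorem centralizer_eq_torusU_of_glDiagonal_eq {m : ↥(unitaryGroupOfForm σ J)} {d : Fin N → Rˣ} (hm : glDiagonal N R d = (m : GL (Fin N) R))
    (hreg : ∀ i j : Fin N, i ≠ j → IsUnit ((d i : R) - d j)) :
    Subgroup.centralizer ({m} : Set ↥(unitaryGroupOfForm σ J)) = torusU σ J := by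
  have hmat : ((m : GL (Fin N) R) : Matrix (Fin N) (Fin N) R) = diagonal fun k => (d k : R) := by
    rw [← coe_glDiagonal, hm]
  ext g
  rw [Subgroup.mem_centralizer_singleton_iff, mem_torusU_iff_forall_apply_eq_zero]
  constructor
  · intro h i j hij
    have h' := congrArg (fun x : ↥(unitaryGroupOfForm σ J) => (((x : GL (Fin N) R)) : Matrix (Fin N) (Fin N) R) i j) h
    simp only [Subgroup.coe_mul, Units.val_mul, hmat, mul_diagonal, diagonal_mul] at h'
    -- `g_ij d_j = d_i g_ij`
    have e : ((g : GL (Fin N) R) : Matrix (Fin N) (Fin N) R) i j * ((d j : R) - d i) = 0 := by rw [mul_sub, h']; ring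
    exact (hreg j i (Ne.symm hij)).mul_left_eq_zero.1 e
  · intro h
    obtain ⟨d', hd'⟩ := (mem_torusU_iff_forall_apply_eq_zero σ J g).2 h
    have hg : ((g : GL (Fin N) R) : Matrix (Fin N) (Fin N) R) = diagonal fun k => (d' k : R) := by
      rw [← coe_glDiagonal, hd', Subgroup.coe_subtype]
    apply Subtype.ext
    apply Units.ext
    show ((g : GL (Fin N) R) : Matrix (Fin N) (Fin N) R) * ((m : GL (Fin N) R) : Matrix (Fin N) (Fin N) R) =
      ((m : GL (Fin N) R) : Matrix (Fin N) (Fin N) R) * ((g : GL (Fin N) R) : Matrix (Fin N) (Fin N) R)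
    rw [hmat, hg, diagonal_mul_diagonal, diagonal_mul_diagonal]
    congr 1
    funext k
    exact mul_comm _ _

/-- **(A1) from `IsRegularElt`**: a regular element of the diagonal torus has centraliser exactly the torus. [cite: Rogawski1990, §12.5 p. 182; §3.1 p. 19] -/
theorem centralizer_eq_torusU_of_isRegularElt {m : ↥(unitaryGroupOfForm σ J)} (hm : m ∈ torusU σ J) (hreg : IsRegularElt (m : GL (Fin N) R)) :
    Subgroup.centralizer ({m} : Set ↥(unitaryGroupOfForm σ J)) = torusU σ J := by
  obtain ⟨d, hd⟩ := hm
  have hd' : glDiagonal N R d = (m : GL (Fin N) R) := by rw [hd, Subgroup.coe_subtype]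
  rw [← hd'] at hreg
  exact centralizer_eq_torusU_of_glDiagonal_eq σ J hd fun i j hij => isUnit_sub_of_isRegularElt_glDiagonal hreg hij

end Centraliser

/-! ## §3 (A3) The fibres of `(gM, m) ↦ g m g⁻¹` are `N(M)∕M`-torsors -/

section Fibres

/-- **(A3) PURE GROUP THEORY.**  If `Z(m) = M = Z(m′)` and `g m g⁻¹ = g′ m′ g′⁻¹`, then `n := g⁻¹ g′` NORMALISES `M`, `m = n m′ n⁻¹` and `g′ = g n` (centralisers are
transported by conjugation: `M = Z(m) = Z(n m′ n⁻¹) = n Z(m′) n⁻¹ = n M n⁻¹`). [cite: Rogawski1990, §12.5 p. 182] [cite: vanDijk1972, §2] -/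
theorem exists_mem_normalizer_of_conj_eq_conj {G : Type*} [Group G] {M : Subgroup G} {m m' g g' : G}
    (hm : Subgroup.centralizer ({m} : Set G) = M) (hm' : Subgroup.centralizer ({m'} : Set G) = M) (h : g * m * g⁻¹ = g' * m' * g'⁻¹) :
    ∃ n ∈ Subgroup.normalizer (M : Set G), m = n * m' * n⁻¹ ∧ g' = g * n := by
  refine ⟨g⁻¹ * g', ?_, ?_, by group⟩
  · rw [Subgroup.mem_normalizer_iff]
    intro x
    have h1 : x ∈ M ↔ x * m' = m' * x := by rw [← hm', Subgroup.mem_centralizer_singleton_iff]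
    have h2 : g⁻¹ * g' * x * (g⁻¹ * g')⁻¹ ∈ M ↔ g⁻¹ * g' * x * (g⁻¹ * g')⁻¹ * m = m * (g⁻¹ * g' * x * (g⁻¹ * g')⁻¹) := by
      rw [← hm, Subgroup.mem_centralizer_singleton_iff]
    rw [h1, h2]
    have hmm : m = g⁻¹ * g' * m' * (g⁻¹ * g')⁻¹ := by
      calc m = g⁻¹ * (g * m * g⁻¹) * g := by group
        _ = g⁻¹ * (g' * m' * g'⁻¹) * g := by rw [h]
        _ = g⁻¹ * g' * m' * (g⁻¹ * g')⁻¹ := by group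
    constructor
    · intro hx
      rw [hmm]
      calc g⁻¹ * g' * x * (g⁻¹ * g')⁻¹ * (g⁻¹ * g' * m' * (g⁻¹ * g')⁻¹) = g⁻¹ * g' * (x * m') * (g⁻¹ * g')⁻¹ := by group
        _ = g⁻¹ * g' * (m' * x) * (g⁻¹ * g')⁻¹ := by rw [hx]
        _ = g⁻¹ * g' * m' * (g⁻¹ * g')⁻¹ * (g⁻¹ * g' * x * (g⁻¹ * g')⁻¹) := by group
    · intro hx
      rw [hmm] at hx
      have e : g⁻¹ * g' * (x * m') * (g⁻¹ * g')⁻¹ = g⁻¹ * g' * (m' * x) * (g⁻¹ * g')⁻¹ := by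
        calc g⁻¹ * g' * (x * m') * (g⁻¹ * g')⁻¹ = g⁻¹ * g' * x * (g⁻¹ * g')⁻¹ * (g⁻¹ * g' * m' * (g⁻¹ * g')⁻¹) := by group
          _ = g⁻¹ * g' * m' * (g⁻¹ * g')⁻¹ * (g⁻¹ * g' * x * (g⁻¹ * g')⁻¹) := hx
          _ = g⁻¹ * g' * (m' * x) * (g⁻¹ * g')⁻¹ := by group
      calc x * m' = (g⁻¹ * g')⁻¹ * (g⁻¹ * g' * (x * m') * (g⁻¹ * g')⁻¹) * (g⁻¹ * g') := by group
        _ = (g⁻¹ * g')⁻¹ * (g⁻¹ * g' * (m' * x) * (g⁻¹ * g')⁻¹) * (g⁻¹ * g') := by rw [e]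
        _ = m' * x := by group
  · calc m = g⁻¹ * (g * m * g⁻¹) * g := by group
      _ = g⁻¹ * (g' * m' * g'⁻¹) * g := by rw [h]
      _ = g⁻¹ * g' * m' * (g⁻¹ * g')⁻¹ := by group

variable {R : Type*} [CommRing R] (σ : R →+* R) {N : ℕ} (J : Matrix (Fin N) (Fin N) R)

/-- **(A3) on the diagonal torus**: two presentations `g m g⁻¹ = g′ m′ g′⁻¹` with `m, m′ ∈ T` regular (unit differences) differ by `n ∈ N(T)`: `g′ = g n`, `m = n m′ n⁻¹`.
[cite: Rogawski1990, §12.5 p. 182] [cite: vanDijk1972, §2] -/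
theorem exists_mem_normalizer_torusU_of_conj_eq_conj {m m' g g' : ↥(unitaryGroupOfForm σ J)} {d d' : Fin N → Rˣ}
    (hm : glDiagonal N R d = (m : GL (Fin N) R)) (hreg : ∀ i j : Fin N, i ≠ j → IsUnit ((d i : R) - d j))
    (hm' : glDiagonal N R d' = (m' : GL (Fin N) R)) (hreg' : ∀ i j : Fin N, i ≠ j → IsUnit ((d' i : R) - d' j))
    (h : g * m * g⁻¹ = g' * m' * g'⁻¹) :
    ∃ n ∈ Subgroup.normalizer (torusU σ J : Set ↥(unitaryGroupOfForm σ J)), m = n * m' * n⁻¹ ∧ g' = g * n :=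
  exists_mem_normalizer_of_conj_eq_conj (centralizer_eq_torusU_of_glDiagonal_eq σ J hm hreg) (centralizer_eq_torusU_of_glDiagonal_eq σ J hm' hreg') h

end Fibres

end Summit.HodgeConjecture.HodgeConjecture.Cruxes.H413.F0P3cStCharTSWeylHypFibre
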